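import Literature.NumberTheory.EllipticCurves.ZpExtensionLayerCharacter
import Literature.NumberTheory.GaloisRepresentations.BrauerCyclicLayer
import Literature.NumberTheory.NumberFields.CMFieldRelativeClassNumberDivisibility
import HarnessLib

/-!
# The norm `Cl(K_j) → Cl(K_k)` between two layers of a `ℤ_p`-extension is `Γ_K`-EQUIVARIANT: `N(g|_{K_j} • c) = g|_{K_k} • N(c)` for every `g ∈ Γ_K`
# (the `Λ = ℤ_p⟦Γ⟧`-module structure of `X = lim_← A_k`; Washington §13.3)

Topic `NumberTheory/IwasawaTheory` (namespace = path).  THEOREM-ONLY file (no definition, no named fact, no `sorry`), written by the prover seat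
`bsd-wall-rtt-p4-w2` g20 (cell `bsd-wall`; `--supports` stmt-BirchSwinnertonDyer-21438, line `nonsquare-descent` stub S2; closes nothing; BSD is proved for no
curve here).  Companion of `ZpExtensionNormKernelLayerPair.lean` / `ZpExtensionLayerNormSurjective.lean`.  ANY `Algebra (κ.layer k) (κ.layer j)` compatible with
`K` (`IsScalarTower K (κ.layer k) (κ.layer j)`) is allowed: such a structure map is the inclusion `K_k ⊆ K_j ⊆ K̄` twisted by an element of the ABELIAN group
`Gal(K_k/K)` (private `exists_aut_layer_forall_algebraMap_eq`), so it still intertwines the restrictions of every `g ∈ Γ_K` (`absRestrictNormalHom_layer_algebraMap`).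

* `absRestrictNormalHom_layer_algebraMap` — `g|_{K_j} (i x) = i (g|_{K_k} x)` for the structure map `i : K_k → K_j` and every `g ∈ Γ_K`.
* **`classGroupNorm_layer_layer_mulEquiv_intAut_absRestrictNormalHom`** — `N_{K_j/K_k} (g|_{K_j} • c) = g|_{K_k} • N_{K_j/K_k} c` on ideal classes
  (tree `classGroupNorm_mulEquiv_intAut`, Okazaki's semilinear equivariance).
* `mulEquiv_intAut_eq_of_forall_coe_eq_smul` — an automorphism `σ ∈ Gal(K_j/K_k)` acting on `K_j ⊆ K̄` as `g` (e.g. the generator `σ = γ^{p^k}|_{K_j}` of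
  `ZpExtensionNormKernelLayerPair.exists_aut_layer_layer_eq_topGenerator_pow`) acts on `Cl(K_j)` as `g|_{K_j}` (same automorphism of `𝓞 K_j`).

References: [Washington1997] §13.2–§13.3 (the `Λ`-module `X = lim A_n`, `Γ` acting on each `A_n`, norms `Γ`-equivariant); [Okazaki2000] §5 proof of Prop. 27.
-/

noncomputable section

open scoped NumberField
open NumberField IsDedekindDomain Field Ideal

namespace Literature.NumberTheory.IwasawaTheory

open Literature.NumberTheory.EllipticCurves Literature.NumberTheory.NumberFields
  Literature.NumberTheory.GaloisRepresentations

variable {K : Type} [Field K] [NumberField K] {p : ℕ} [hp : Fact p.Prime] (κ : ZpExtension K p)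

/-- `Gal(K_k/K)` is commutative (it is cyclic: tree `exists_cyclicCharacter_layer`, `isCyclic_of_cyclicLayer`). [cite: Washington1997, §13.1 (`Gal(K_n/K) ≅ ℤ/pⁿ`)] -/
theorem mul_comm_aut_layer (k : ℕ) (a b : (κ.layer k) ≃ₐ[K] (κ.layer k)) : a * b = b * a := by
  haveI : IsGalois K (κ.layer k) := κ.isGalois_layer_holds k
  haveI : NeZero (p ^ k) := ⟨pow_ne_zero k hp.out.ne_zero⟩
  obtain ⟨ψ, -, hker, -⟩ := κ.exists_cyclicCharacter_layer k
  haveI : IsCyclic ((κ.layer k) ≃ₐ[K] (κ.layer k)) := isCyclic_of_cyclicLayer ψ (κ.layer k) hker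
  obtain ⟨g, hg⟩ := IsCyclic.exists_generator (α := (κ.layer k) ≃ₐ[K] (κ.layer k))
  obtain ⟨m, rfl⟩ := Subgroup.mem_zpowers_iff.mp (hg a)
  obtain ⟨n, rfl⟩ := Subgroup.mem_zpowers_iff.mp (hg b)
  exact Commute.zpow_zpow_self g m n

variable {k j : ℕ} [Algebra (κ.layer k) (κ.layer j)] [IsScalarTower K (κ.layer k) (κ.layer j)]

omit [NumberField K] in
/-- **A compatible structure map `K_k → K_j` is the inclusion twisted by an automorphism of `K_k`**: there is `τ ∈ Gal(K_k/K)` with `i x = τ x` in `K̄` for all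
`x ∈ K_k` (`K_k/K` is normal, so the `K`-embedding `K_k → K_j ⊆ K̄` lands in `K_k`: Mathlib `AlgHom.restrictNormal'`). [folklore] -/
private theorem exists_aut_layer_forall_algebraMap_eq [Normal K (κ.layer k)] :
    ∃ τ : (κ.layer k) ≃ₐ[K] (κ.layer k), ∀ x : κ.layer k,
      ((algebraMap (κ.layer k) (κ.layer j) x : κ.layer j) : AlgebraicClosure K) = ((τ x : κ.layer k) : AlgebraicClosure K) := by
  let φ : (κ.layer k) →ₐ[K] AlgebraicClosure K := (κ.layer j).val.comp (IsScalarTower.toAlgHom K (κ.layer k) (κ.layer j))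
  refine ⟨φ.restrictNormal' (κ.layer k), fun x => ?_⟩
  have h := AlgHom.restrictNormal_commutes φ (κ.layer k) x
  rw [AlgHom.restrictNormal', AlgEquiv.coe_ofBijective]
  exact h.symm

/-- **`g|_{K_j} ∘ i = i ∘ g|_{K_k}`** for the structure map `i : K_k → K_j` of any compatible algebra structure and every `g ∈ Γ_K` (the twist `τ` of
`exists_aut_layer_forall_algebraMap_eq` commutes with `g|_{K_k}` in the abelian `Gal(K_k/K)`). [cite: Washington1997, §13.3 (norm maps `A_m → A_n` are `Γ`-maps)] -/
theorem absRestrictNormalHom_layer_algebraMap [Normal K (κ.layer k)] [Normal K (κ.layer j)] (g : absoluteGaloisGroup K) (x : κ.layer k) :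
    absRestrictNormalHom (κ.layer j) g (algebraMap (κ.layer k) (κ.layer j) x) =
      algebraMap (κ.layer k) (κ.layer j) (absRestrictNormalHom (κ.layer k) g x) := by
  obtain ⟨τ, hτ⟩ : ∃ τ : (κ.layer k) ≃ₐ[K] (κ.layer k), ∀ x : κ.layer k,
      ((algebraMap (κ.layer k) (κ.layer j) x : κ.layer j) : AlgebraicClosure K) = ((τ x : κ.layer k) : AlgebraicClosure K) :=
    exists_aut_layer_forall_algebraMap_eq κ
  apply Subtype.ext
  have h1 : ((absRestrictNormalHom (κ.layer j) g (algebraMap (κ.layer k) (κ.layer j) x) : κ.layer j) : AlgebraicClosure K) =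
      g • ((algebraMap (κ.layer k) (κ.layer j) x : κ.layer j) : AlgebraicClosure K) := by
    rw [absoluteGaloisGroup.smul_def]
    exact AlgEquiv.restrictNormal_commutes (absoluteGaloisGroup.toAlgEquiv K g) (κ.layer j) _
  have h2 : ∀ y : κ.layer k, ((absRestrictNormalHom (κ.layer k) g y : κ.layer k) : AlgebraicClosure K) = g • ((y : κ.layer k) : AlgebraicClosure K) :=
    fun y => by
      rw [absoluteGaloisGroup.smul_def]
      exact AlgEquiv.restrictNormal_commutes (absoluteGaloisGroup.toAlgEquiv K g) (κ.layer k) _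
  have hcomm : τ (absRestrictNormalHom (κ.layer k) g x) = absRestrictNormalHom (κ.layer k) g (τ x) := by
    have := mul_comm_aut_layer κ k τ (absRestrictNormalHom (κ.layer k) g)
    exact AlgEquiv.congr_fun this x
  rw [h1, hτ x, hτ, hcomm, h2]

/-- **`N_{K_j/K_k}` is `Γ_K`-equivariant on ideal classes**: `N (g|_{K_j} • c) = g|_{K_k} • N c` for every `g ∈ Γ_K` (actions through
`ClassGroup.mulEquiv (AmbiguousClass.intAut ·)`), for any compatible algebra structure `K_k → K_j` — the transition maps of `X = lim_← Cl(K_k)` are maps of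
`Γ`-modules. [cite: Washington1997, §13.3 (proof of Thm. 13.13: `X` is a `Λ`-module, `A_n ≅ X/…` as `Λ`-modules)] [cite: Okazaki2000, §5, proof of Prop. 27] -/
theorem classGroupNorm_layer_layer_mulEquiv_intAut_absRestrictNormalHom [Normal K (κ.layer k)] [Normal K (κ.layer j)]
    [NumberField (κ.layer k)] [NumberField (κ.layer j)] (g : absoluteGaloisGroup K) (c : ClassGroup (𝓞 (κ.layer j))) :
    classGroupNorm (κ.layer k) (κ.layer j) (ClassGroup.mulEquiv (AmbiguousClass.intAut (absRestrictNormalHom (κ.layer j) g)) c) =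
      ClassGroup.mulEquiv (AmbiguousClass.intAut (absRestrictNormalHom (κ.layer k) g)) (classGroupNorm (κ.layer k) (κ.layer j) c) :=
  classGroupNorm_mulEquiv_intAut (κ.layer k) (κ.layer j) (absRestrictNormalHom (κ.layer j) g) (absRestrictNormalHom (κ.layer k) g)
    (fun x => absRestrictNormalHom_layer_algebraMap κ g x) c

omit [NumberField K] [IsScalarTower K (κ.layer k) (κ.layer j)] in
/-- An automorphism `σ` of `K_j` (over `K_k`) acting on `K_j ⊆ K̄` as `g ∈ Γ_K` induces the same automorphism of `𝓞 K_j` as `g|_{K_j}`. [folklore] -/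
private theorem intAut_eq_intAut_absRestrictNormalHom [Normal K (κ.layer j)] {g : absoluteGaloisGroup K} {σ : (κ.layer j) ≃ₐ[κ.layer k] (κ.layer j)}
    (hσ : ∀ x : κ.layer j, ((σ x : κ.layer j) : AlgebraicClosure K) = g • (x : AlgebraicClosure K)) :
    AmbiguousClass.intAut σ = AmbiguousClass.intAut (absRestrictNormalHom (κ.layer j) g) := by
  refine RingEquiv.ext fun x => Subtype.ext (Subtype.ext ?_)
  change ((σ (x : κ.layer j) : κ.layer j) : AlgebraicClosure K) = ((absRestrictNormalHom (κ.layer j) g (x : κ.layer j) : κ.layer j) : AlgebraicClosure K)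
  rw [hσ, absoluteGaloisGroup.smul_def]
  exact (AlgEquiv.restrictNormal_commutes (absoluteGaloisGroup.toAlgEquiv K g) (κ.layer j) _).symm

omit [NumberField K] [IsScalarTower K (κ.layer k) (κ.layer j)] in
/-- **Same action on `Cl(K_j)`**: for `σ ∈ Gal(K_j/K_k)` acting on `K_j ⊆ K̄` as `g ∈ Γ_K` (e.g. `σ = γ^{p^k}|_{K_j}`, `g = γ^{p^k}`), `σ • c = g|_{K_j} • c` for every
ideal class `c` — so «`ω_k = γ^{p^k} − 1`» of `ZpExtensionNormKernelLayerPair` is computed in the `Γ`-module structure of `Cl(K_j)`.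
[cite: Washington1997, §13.3 (proof of Thm. 13.13: `Γ` acts on `A_n` through `Gal(K_n/K)`, `ω_n = γ^{pⁿ} − 1`)] -/
theorem mulEquiv_intAut_eq_of_forall_coe_eq_smul [Normal K (κ.layer j)] [NumberField (κ.layer j)] {g : absoluteGaloisGroup K}
    {σ : (κ.layer j) ≃ₐ[κ.layer k] (κ.layer j)} (hσ : ∀ x : κ.layer j, ((σ x : κ.layer j) : AlgebraicClosure K) = g • (x : AlgebraicClosure K))
    (c : ClassGroup (𝓞 (κ.layer j))) :
    ClassGroup.mulEquiv (AmbiguousClass.intAut σ) c = ClassGroup.mulEquiv (AmbiguousClass.intAut (absRestrictNormalHom (κ.layer j) g)) c := by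
  rw [intAut_eq_intAut_absRestrictNormalHom κ hσ]

end Literature.NumberTheory.IwasawaTheory

end
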